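import Summits.HodgeConjecture.HodgeConjecture.Theorems.F0P6aKottwitzCountAtSplitPlace       -- ★ p847313: `exists_cmType_adapted` and its §2–§3 block lemmas
import Summits.HodgeConjecture.HodgeConjecture.Theorems.F0P6aEmbeddingTorsorPlaces          -- ★ (GEN A-p18): torsor `τ = τ_w ∘ g`, `τ_w ∘ g ↦ g⁻¹ • w`, `c` central
import Summits.HodgeConjecture.HodgeConjecture.Theorems.F0P6aKottwitzAtOmegaOfComplexPoints  -- ★ p847344: `comp_eq_comp_of_isGalois`
import HarnessLib

/-!
# Crux `HLiu418` — P6 sub-line **F0-P6a**, organ (a) of «M-57b»: the UNMIXED adapted frame CM type at a split place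

Cell `hodgecm-mathlib`, crux `stmt-HodgeConjecture-24832` (HLiu418), `--supports` only (count-neutral).  LEAD F0P6-plan (g3) «M-57b» (1)(a)
(2026-09-02T02:13Z): the auxiliary CM type `Φ` chosen at a split place `w` (★ p847313 `exists_cmType_adapted`: a CM type of `p`-adic embeddings
`τ : F →+* F̄_w` through the structural `τ_w`, containing the `c • w`-block off `τ_w ∘ c`) can moreover be chosen **UNMIXED** («place-determined on the
banal blocks»): two embeddings inducing the SAME prime `ker (residue ∘ τR τ) = ker (residue ∘ τR τ')`, different from `𝔭_w` and from `𝔭_{c•w}`, are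
either both in `Φ` or both outside `Φ`.  With such a frame every banal block of the Kottwitz signature is constant (`∈ {0, 2}` by `mOf`), so every banal
block of the `𝔭`-torsion is étale or multiplicative (LEAD «M-57b» (1): «Q-MIX is dissolved, not paid»).  CONSUMER: the KOTT leaf
`Cruxes/HLiu418/Lines/F0_P6a_StubKOTT.lean` ED. 2 (`def UnmixedAt`, `exists_adapted_unmixed_frame`, pen A-p14 (g35)), via §4 below.

THE MATHEMATICS ([RapoportSmithlingZhang2020Diagonal] §3.2 p. 10, §4.1 (4.6) p. 16–17; [Shimura1998] §18.2 Lemma (i) and the remark after it: complex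
conjugation is central).  For `F` Galois over `ℚ` every embedding `τ : F →+* F̄_w` is `τ_w ∘ g` with `g ∈ Gal(F∕ℚ)` (normality), so the prime it
induces is `g⁻¹ • 𝔭_w` (★ `F0P6aEmbeddingTorsorPlaces`); since `c` is central, `c • (g⁻¹ • 𝔭_w) = g⁻¹ • 𝔭_{c•w} ≠ g⁻¹ • 𝔭_w` at a split place:
**conjugation moves EVERY block** (§2 `ker_residue_restrict_comp_complexConj_ne`).  Hence the blocks other than `𝔭_w`, `𝔭_{c•w}` fall into free
`c`-orbits `{u, c • u}`, and a CM type may take ONE WHOLE BLOCK out of each orbit (§1, the abstract selection `exists_cmType_frame_unmixed`: a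
block-invariant, block-separating numbering `R` picks the block with the smaller number), together with `{τ_w} ∪ (H_{c•w} ∖ {τ_w ∘ c})` on the
distinguished pair (§3 THE HEAD `exists_cmType_adapted_unmixed`, same currency as ★ `exists_cmType_adapted` + the unmixed conjunct).  §4 pushes the
unmixed conjunct forward along a complex embedding `σ₀ : F̄_w →+* ℂ` over `ι₁` (shape of `KottAdaptedAt`, conclusion `σ ∘ τ ∈ Φ ↔ σ ∘ τ' ∈ Φ`), as ★
`kottAdaptedAt_image_of_block_subset` does for the adapted conjunct.

THEOREMS ONLY (no definition, no `sorry`, no new named fact).  HC_CM is proved only modulo the 7 printed citations (2 remaining named inputs hLiu418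
24832, h413 24833) until rung 0 closes; nothing here changes a count.

[cite: RapoportSmithlingZhang2020Diagonal, §3.2 p. 10; §4.1 (4.6) p. 16 and p. 17] [cite: Shimura1998, §18.2 Lemma (i) and the remark following its proof]
[cite: NeukirchANT1999, Ch. II (8.1) and (9.1)]
-/

set_option autoImplicit false

-- `Summit.HodgeConjecture.HodgeConjecture.…` repeats `HodgeConjecture` by design (D-0017).
set_option linter.dupNamespace false

noncomputable section

open NumberField IsDedekindDomain IsLocalRing
open scoped Pointwise
open Literature.NumberTheory.GaloisRepresentations (closureValuationSubring)
open Literature.NumberTheory.Automorphic (instMulActionHeightOneSpectrum HeightOneSpectrum.smul_asIdeal)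
open Literature.NumberTheory.ComplexMultiplication (comp_complexConj_comp_complexConj)
open Literature.AlgebraicGeometry.ComplexMultiplication.GaloisOcticStabiliser.GaloisOctic (complexConj_mul_comm)
open Summit.HodgeConjecture.HodgeConjecture.Theorems.F0P6aKottwitzCountAtSplitPlace (
  ker_residue_restrict_comp_complexConj ker_residue_restrict_structural ker_residue_restrict_structural_comp_complexConj)
open Summit.HodgeConjecture.HodgeConjecture.Theorems.F0P6aEmbeddingTorsorPlaces (exists_algEquiv_eq_structural_comp
  ker_residue_restrict_structural_comp_algEquiv)
open Summit.HodgeConjecture.HodgeConjecture.Theorems.F0P6aKottwitzAtOmegaOfComplexPoints (comp_eq_comp_of_isGalois)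

namespace Summit.HodgeConjecture.HodgeConjecture.Theorems.F0P6aKottwitzUnmixedFrame

/-! ### §1 The abstract selection: an unmixed frame CM type for a block map -/

section Abstract

variable {ι β : Type*} [Fintype ι] (σ : ι → ι) (k : ι → β)

/-- **THE UNMIXED FRAME CM TYPE EXISTS (abstract)**: let `σ` be an involution of a finite set `ι` («`τ ↦ τ ∘ c`») and `k : ι → β` a block map («the
induced prime») compatible with `σ` (`k i = k j → k (σ i) = k (σ j)`) such that `σ` MOVES EVERY BLOCK (`k (σ i) ≠ k i`).  Then for every `i₀` there is a CM
type `Φ ∋ i₀` (`i ∈ Φ ↔ σ i ∉ Φ`) containing the block of `σ i₀` off `σ i₀` and UNMIXED off the two distinguished blocks: `k i = k j ∉ {k i₀, k (σ i₀)} →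
(i ∈ Φ ↔ j ∈ Φ)` (take `{i₀} ∪ (k⁻¹(k (σ i₀)) ∖ {σ i₀})` and, from each free `σ`-orbit of banal blocks, the whole block with the smaller value of a
block-separating numbering). [cite: RapoportSmithlingZhang2020Diagonal, §3.2 p. 10] -/
theorem exists_cmType_frame_unmixed (hσ : ∀ i, σ (σ i) = i) (hk : ∀ i j, k i = k j → k (σ i) = k (σ j))
    (hk' : ∀ i, k (σ i) ≠ k i) (i₀ : ι) :
    ∃ Φ : Finset ι, i₀ ∈ Φ ∧ (∀ i, i ∈ Φ ↔ σ i ∉ Φ) ∧ (∀ i, k i = k (σ i₀) → i ≠ σ i₀ → i ∈ Φ) ∧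
      ∀ i j, k i = k j → k i ≠ k i₀ → k i ≠ k (σ i₀) → (i ∈ Φ ↔ j ∈ Φ) := by
  classical
  -- an injective numbering of `ι` and the induced block invariant `R i := min { r j | k j = k i }`
  obtain ⟨r, hr⟩ : ∃ r : ι → ℕ, Function.Injective r :=
    ⟨fun i => (Fintype.equivFin ι i : ℕ), fun i j h => (Fintype.equivFin ι).injective (Fin.ext h)⟩
  let R : ι → WithTop ℕ := fun i => ((Finset.univ.filter fun j => k j = k i).image r).min
  have hRne : ∀ i, ∃ a : ℕ, R i = a := fun i =>
    Finset.min_of_mem (Finset.mem_image.mpr ⟨i, Finset.mem_filter.mpr ⟨Finset.mem_univ _, rfl⟩, rfl⟩)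
  -- (R1) `R` is a block invariant
  have hR₁ : ∀ i j, k i = k j → R i = R j := by
    intro i j h
    show ((Finset.univ.filter fun j => k j = k i).image r).min = ((Finset.univ.filter fun j' => k j' = k j).image r).min
    rw [h]
  -- (R2) `R` separates blocks
  have hR₂ : ∀ i j, R i = R j → k i = k j := by
    intro i j h
    obtain ⟨a, ha⟩ := hRne i
    obtain ⟨i₁, hi₁, hi₁a⟩ := Finset.mem_image.mp (Finset.mem_of_min ha)
    obtain ⟨j₁, hj₁, hj₁a⟩ := Finset.mem_image.mp (Finset.mem_of_min (h ▸ ha))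
    have hij : i₁ = j₁ := hr (hi₁a.trans hj₁a.symm)
    rw [Finset.mem_filter] at hi₁ hj₁
    rw [← hi₁.2, ← hj₁.2, hij]
  -- (R3) hence `σ` changes `R`
  have hR₃ : ∀ i, R i ≠ R (σ i) := fun i h => hk' i (hR₂ i (σ i) h).symm
  -- block bookkeeping around the distinguished pair
  have h₀ : k i₀ ≠ k (σ i₀) := (hk' i₀).symm
  have hσinj : ∀ i j, σ i = σ j → i = j := fun i j h => by rw [← hσ i, h, hσ]
  have hA : ∀ i, k i = k i₀ → k (σ i) = k (σ i₀) := fun i h => hk i i₀ h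
  have hB : ∀ i, k i = k (σ i₀) → k (σ i) = k i₀ := fun i h => by have := hk i (σ i₀) h; rwa [hσ] at this
  have hC₁ : ∀ i, k i ≠ k (σ i₀) → k (σ i) ≠ k i₀ := fun i h h' => h (by have := hk (σ i) i₀ h'; rwa [hσ] at this)
  have hC₂ : ∀ i, k i ≠ k i₀ → k (σ i) ≠ k (σ i₀) := fun i h h' => h (by have := hk (σ i) (σ i₀) h'; rwa [hσ, hσ] at this)
  -- the CM type: `{i₀}`, the `σ i₀`-block off `σ i₀`, and one whole block out of every free orbit of banal blocks
  refine ⟨insert i₀ (Finset.univ.filter fun i => k i = k (σ i₀) ∧ i ≠ σ i₀) ∪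
      Finset.univ.filter fun i => k i ≠ k i₀ ∧ k i ≠ k (σ i₀) ∧ R i < R (σ i), ?_, ?_, ?_, ?_⟩
  · exact Finset.mem_union_left _ (Finset.mem_insert_self _ _)
  · -- the CM condition, by cases on the block of `i`
    intro i
    simp only [Finset.mem_union, Finset.mem_insert, Finset.mem_filter, Finset.mem_univ, true_and, hσ]
    by_cases h₁ : k i = k i₀
    · -- the `i₀`-block: `i ∈ Φ ↔ i = i₀`, `σ i ∈ Φ ↔ σ i ≠ σ i₀`
      have h₁' : k (σ i) = k (σ i₀) := hA i h₁
      constructor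
      · rintro ((rfl | ⟨h, -⟩) | ⟨h, -⟩)
        · rintro ((h | ⟨-, h⟩) | ⟨-, h, -⟩)
          · exact absurd (congrArg k h) (hk' _)
          · exact h rfl
          · exact h h₁'
        · exact absurd (h₁.symm.trans h) h₀
        · exact absurd h₁ h
      · intro h
        left; left
        by_contra hne
        exact h (Or.inl (Or.inr ⟨h₁', fun h' => hne (hσinj _ _ h')⟩))
    · by_cases h₂ : k i = k (σ i₀)
      · -- the `σ i₀`-block: `i ∈ Φ ↔ i ≠ σ i₀`, `σ i ∈ Φ ↔ σ i = i₀`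
        have h₂' : k (σ i) = k i₀ := hB i h₂
        constructor
        · rintro ((rfl | ⟨-, h⟩) | ⟨-, h, -⟩)
          · exact absurd rfl h₁
          · rintro ((h' | ⟨h', -⟩) | ⟨h', -⟩)
            · exact h (by rw [← h', hσ])
            · exact h₀ (h₂'.symm.trans h')
            · exact h' h₂'
          · exact absurd h₂ h
        · intro h
          left; right
          refine ⟨h₂, fun h' => h (Or.inl (Or.inl ?_))⟩
          rw [h', hσ]
      · -- a banal block: `i ∈ Φ ↔ R i < R (σ i)`, `σ i ∈ Φ ↔ R (σ i) < R i`
        have h₃ : k (σ i) ≠ k i₀ := hC₁ i h₂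
        have h₄ : k (σ i) ≠ k (σ i₀) := hC₂ i h₁
        constructor
        · rintro ((rfl | ⟨h, -⟩) | ⟨-, -, h⟩)
          · exact absurd rfl h₁
          · exact absurd h h₂
          · rintro ((h' | ⟨h', -⟩) | ⟨-, -, h'⟩)
            · exact h₃ (congrArg k h')
            · exact h₄ h'
            · exact lt_asymm h h'
        · intro h
          right
          refine ⟨h₁, h₂, ?_⟩
          rcases lt_trichotomy (R i) (R (σ i)) with hlt | heq | hgt
          · exact hlt
          · exact absurd heq (hR₃ i)
          · exact absurd (Or.inr ⟨h₃, h₄, hgt⟩) h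
  · -- adapted: the `σ i₀`-block off `σ i₀` is inside
    intro i hi hne
    exact Finset.mem_union_left _ (Finset.mem_insert_of_mem (Finset.mem_filter.mpr ⟨Finset.mem_univ _, hi, hne⟩))
  · -- unmixed off the distinguished pair
    intro i j hij h₁ h₂
    have h₁' : k j ≠ k i₀ := hij ▸ h₁
    have h₂' : k j ≠ k (σ i₀) := hij ▸ h₂
    have hRi : R i = R j := hR₁ i j hij
    have hRσ : R (σ i) = R (σ j) := hR₁ _ _ (hk i j hij)
    simp only [Finset.mem_union, Finset.mem_insert, Finset.mem_filter, Finset.mem_univ, true_and]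
    constructor
    · rintro ((rfl | ⟨h, -⟩) | ⟨-, -, h⟩)
      · exact absurd rfl h₁
      · exact absurd h h₂
      · exact Or.inr ⟨h₁', h₂', by rwa [← hRi, ← hRσ]⟩
    · rintro ((rfl | ⟨h, -⟩) | ⟨-, -, h⟩)
      · exact absurd rfl h₁'
      · exact absurd h h₂'
      · exact Or.inr ⟨h₁, h₂, by rwa [hRi, hRσ]⟩

end Abstract

/-! ### §2 Conjugation moves EVERY induced prime of a GALOIS CM field at a split place -/

section Galois

variable {F : Type} [Field F] [NumberField F] [IsCMField F] (w : HeightOneSpectrum (𝓞 F))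
  (τR : (F →+* AlgebraicClosure (w.adicCompletion F)) → (𝓞 F →+* ↥(closureValuationSubring (w.adicCompletion F))))
  (hτR : ∀ (τ : F →+* AlgebraicClosure (w.adicCompletion F)) (x : 𝓞 F),
    ((τR τ x : ↥(closureValuationSubring (w.adicCompletion F))) : AlgebraicClosure (w.adicCompletion F)) = τ (x : F))

omit [IsCMField F] in
include hτR in
/-- Every induced prime of the Galois field `F` is a `Gal(F∕ℚ)`-translate of `𝔭_w`: `ker (residue ∘ τR τ) = g • 𝔭_w` for some `g` (★ torsor `τ = τ_w ∘ g⁻¹`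
and ★ `ker_residue_restrict_structural_comp_algEquiv`). [cite: NeukirchANT1999, Ch. II (9.1)] -/
theorem exists_ker_residue_restrict_eq_smul [IsGalois ℚ F] (τ : F →+* AlgebraicClosure (w.adicCompletion F)) :
    ∃ g : F ≃ₐ[ℚ] F, RingHom.ker ((residue ↥(closureValuationSubring (w.adicCompletion F))).comp (τR τ)) = g • w.asIdeal := by
  obtain ⟨g, rfl⟩ := exists_algEquiv_eq_structural_comp w τ
  exact ⟨g⁻¹, by rw [ker_residue_restrict_structural_comp_algEquiv w τR hτR g, HeightOneSpectrum.smul_asIdeal]⟩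

/-- The two actions of complex conjugation on the ideals of `𝓞 F` agree: as an `F⁺`-automorphism and as a `ℚ`-automorphism (`restrictScalars`).
[cite: Shimura1998, §18.2 Lemma (i)] -/
theorem restrictScalars_complexConj_smul_ideal (I : Ideal (𝓞 F)) :
    ((IsCMField.complexConj F).restrictScalars ℚ) • I = (IsCMField.complexConj F) • I := by
  rw [Ideal.pointwise_smul_def, Ideal.pointwise_smul_def]
  congr 1

include hτR in
/-- **CONJUGATION MOVES EVERY BLOCK** of a Galois CM field at a split place: `ker (residue ∘ τR (τ ∘ c)) ≠ ker (residue ∘ τR τ)` for EVERY `τ` — the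
induced prime is `g • 𝔭_w`, its conjugate's is `c • g • 𝔭_w = g • 𝔭_{c•w}` (`c` is central, ★ `complexConj_mul_comm`), and `c • w ≠ w`.
[cite: Shimura1998, §18.2 Lemma (i) and the remark following its proof] [cite: RapoportSmithlingZhang2020Diagonal, §4.1 p. 17] -/
theorem ker_residue_restrict_comp_complexConj_ne [IsGalois ℚ F] (hw : (IsCMField.complexConj F) • w ≠ w)
    (τ : F →+* AlgebraicClosure (w.adicCompletion F)) :
    RingHom.ker ((residue ↥(closureValuationSubring (w.adicCompletion F))).comp
        (τR (τ.comp ((IsCMField.complexConj F : F ≃ₐ[↥(maximalRealSubfield F)] F) : F →+* F)))) ≠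
      RingHom.ker ((residue ↥(closureValuationSubring (w.adicCompletion F))).comp (τR τ)) := by
  obtain ⟨g, hg⟩ := exists_ker_residue_restrict_eq_smul w τR hτR τ
  rw [ker_residue_restrict_comp_complexConj w τR hτR, hg, ← restrictScalars_complexConj_smul_ideal, smul_smul,
    complexConj_mul_comm g, ← smul_smul, restrictScalars_complexConj_smul_ideal]
  intro h
  exact hw (HeightOneSpectrum.ext (MulAction.injective g h))

end Galois

/-! ### §3 THE HEAD: the unmixed adapted frame CM type of `p`-adic embeddings -/

section Head

variable {F : Type} [Field F] [NumberField F] [IsCMField F] (w : HeightOneSpectrum (𝓞 F))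
  (τR : (F →+* AlgebraicClosure (w.adicCompletion F)) → (𝓞 F →+* ↥(closureValuationSubring (w.adicCompletion F))))
  (hτR : ∀ (τ : F →+* AlgebraicClosure (w.adicCompletion F)) (x : 𝓞 F),
    ((τR τ x : ↥(closureValuationSubring (w.adicCompletion F))) : AlgebraicClosure (w.adicCompletion F)) = τ (x : F))

include hτR in
/-- **THE UNMIXED ADAPTED FRAME CM TYPE EXISTS** (organ (a) of «M-57b»; = ★ `exists_cmType_adapted` + the last conjunct): for a Galois CM field at a split
place (`c • w ≠ w`) there is a CM type `Φ` of embeddings `F →+* F̄_w` (`τ ∈ Φ ↔ τ ∘ c ∉ Φ`) through the structural `τ_w`, containing the whole `c • w`-block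
off `τ_w ∘ c`, and UNMIXED on the banal blocks: embeddings inducing the same prime `≠ 𝔭_w, 𝔭_{c•w}` lie in `Φ` together.  §1 fed with ★ §2–§3 of p847313 and
§2 above. [cite: RapoportSmithlingZhang2020Diagonal, §3.2 p. 10; §4.1 (4.6) p. 16 and p. 17] [cite: Shimura1998, §18.2 Lemma (i)] -/
theorem exists_cmType_adapted_unmixed [IsGalois ℚ F] (hw : (IsCMField.complexConj F) • w ≠ w) :
    ∃ Φ : Finset (F →+* AlgebraicClosure (w.adicCompletion F)),
      (algebraMap (w.adicCompletion F) (AlgebraicClosure (w.adicCompletion F))).comp (algebraMap F (w.adicCompletion F)) ∈ Φ ∧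
      (∀ τ, τ ∈ Φ ↔ τ.comp ((IsCMField.complexConj F : F ≃ₐ[↥(maximalRealSubfield F)] F) : F →+* F) ∉ Φ) ∧
      (∀ τ : F →+* AlgebraicClosure (w.adicCompletion F),
        RingHom.ker ((residue ↥(closureValuationSubring (w.adicCompletion F))).comp (τR τ)) = ((IsCMField.complexConj F) • w).asIdeal →
        τ ≠ ((algebraMap (w.adicCompletion F) (AlgebraicClosure (w.adicCompletion F))).comp (algebraMap F (w.adicCompletion F))).comp
          ((IsCMField.complexConj F : F ≃ₐ[↥(maximalRealSubfield F)] F) : F →+* F) → τ ∈ Φ) ∧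
      ∀ τ τ' : F →+* AlgebraicClosure (w.adicCompletion F),
        RingHom.ker ((residue ↥(closureValuationSubring (w.adicCompletion F))).comp (τR τ)) =
          RingHom.ker ((residue ↥(closureValuationSubring (w.adicCompletion F))).comp (τR τ')) →
        RingHom.ker ((residue ↥(closureValuationSubring (w.adicCompletion F))).comp (τR τ)) ≠ w.asIdeal →
        RingHom.ker ((residue ↥(closureValuationSubring (w.adicCompletion F))).comp (τR τ)) ≠ ((IsCMField.complexConj F) • w).asIdeal →
        (τ ∈ Φ ↔ τ' ∈ Φ) := by
  classical
  obtain ⟨Φ, h₀, hcm, hD, hU⟩ := exists_cmType_frame_unmixed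
    (fun τ : F →+* AlgebraicClosure (w.adicCompletion F) => τ.comp ((IsCMField.complexConj F : F ≃ₐ[↥(maximalRealSubfield F)] F) : F →+* F))
    (fun τ => RingHom.ker ((residue ↥(closureValuationSubring (w.adicCompletion F))).comp (τR τ)))
    comp_complexConj_comp_complexConj
    (fun τ τ' h => by
      rw [ker_residue_restrict_comp_complexConj w τR hτR, ker_residue_restrict_comp_complexConj w τR hτR, h])
    (fun τ => ker_residue_restrict_comp_complexConj_ne w τR hτR hw τ)
    ((algebraMap (w.adicCompletion F) (AlgebraicClosure (w.adicCompletion F))).comp (algebraMap F (w.adicCompletion F)))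
  refine ⟨Φ, h₀, hcm, fun τ hτ hne => hD τ ?_ hne, fun τ τ' h h₁ h₂ => hU τ τ' h ?_ ?_⟩
  · rw [hτ, ker_residue_restrict_structural_comp_complexConj w τR hτR]
  · rwa [ker_residue_restrict_structural w τR hτR]
  · rwa [ker_residue_restrict_structural_comp_complexConj w τR hτR]

end Head

/-! ### §4 The push-forward along a complex embedding of `F̄_w` over `ι₁` (shape of `KottAdaptedAt`, conclusion an `↔`) -/

section PushForward

variable {F : Type} [Field F] [NumberField F] [IsCMField F]

omit [IsCMField F] in
/-- `σ₀ ∘ ·` is injective on embeddings `F →+* F̄_w`. [cite: RapoportSmithlingZhang2020Diagonal, §3.2 p. 10] -/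
theorem comp_left_injective (w : HeightOneSpectrum (𝓞 F)) (σ₀ : AlgebraicClosure (w.adicCompletion F) →+* ℂ)
    {τ τ' : F →+* AlgebraicClosure (w.adicCompletion F)} (h : σ₀.comp τ = σ₀.comp τ') : τ = τ' :=
  RingHom.ext fun x => σ₀.injective (RingHom.congr_fun h x)

/-- **THE PUSHED-FORWARD FRAME IS UNMIXED**: if a finite set `Φw` of `p`-adic embeddings is unmixed on the banal blocks with respect to ONE restriction
family `τR₀` (§3, last conjunct), then the complex frame `Φ := {σ₀ ∘ τ ∣ τ ∈ Φw}` satisfies, for EVERY restriction family `τR` (they coincide) and EVERY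
`σ : F̄_w →+* ℂ` over `ι₁` (its values on embeddings of the Galois field `F` are those of `σ₀`, ★ `comp_eq_comp_of_isGalois`), the banal-block law
`σ ∘ τ ∈ Φ ↔ σ ∘ τ' ∈ Φ` — the body of the KOTT leaf՚s ED. 2 `UnmixedAt ι₁ w Φ`. [cite: RapoportSmithlingZhang2020Diagonal, §3.2 p. 10; §4.1 p. 17] -/
theorem comp_mem_image_iff_of_unmixed [IsGalois ℚ F] (ι₁ : F →+* ℂ) (w : HeightOneSpectrum (𝓞 F))
    (σ₀ : AlgebraicClosure (w.adicCompletion F) →+* ℂ)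
    (hσ₀ : σ₀.comp ((algebraMap (w.adicCompletion F) (AlgebraicClosure (w.adicCompletion F))).comp (algebraMap F (w.adicCompletion F))) = ι₁)
    (τR₀ : (F →+* AlgebraicClosure (w.adicCompletion F)) → (𝓞 F →+* ↥(closureValuationSubring (w.adicCompletion F))))
    (hτR₀ : ∀ (τ : F →+* AlgebraicClosure (w.adicCompletion F)) (x : 𝓞 F),
      ((τR₀ τ x : ↥(closureValuationSubring (w.adicCompletion F))) : AlgebraicClosure (w.adicCompletion F)) = τ (x : F))
    (Φw : Finset (F →+* AlgebraicClosure (w.adicCompletion F)))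
    (hunmixed : ∀ τ τ' : F →+* AlgebraicClosure (w.adicCompletion F),
      RingHom.ker ((residue ↥(closureValuationSubring (w.adicCompletion F))).comp (τR₀ τ)) =
        RingHom.ker ((residue ↥(closureValuationSubring (w.adicCompletion F))).comp (τR₀ τ')) →
      RingHom.ker ((residue ↥(closureValuationSubring (w.adicCompletion F))).comp (τR₀ τ)) ≠ w.asIdeal →
      RingHom.ker ((residue ↥(closureValuationSubring (w.adicCompletion F))).comp (τR₀ τ)) ≠ ((IsCMField.complexConj F) • w).asIdeal →
      (τ ∈ Φw ↔ τ' ∈ Φw))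
    (τR : (F →+* AlgebraicClosure (w.adicCompletion F)) → (𝓞 F →+* ↥(closureValuationSubring (w.adicCompletion F))))
    (hτR : ∀ (τ : F →+* AlgebraicClosure (w.adicCompletion F)) (x : 𝓞 F),
      ((τR τ x : ↥(closureValuationSubring (w.adicCompletion F))) : AlgebraicClosure (w.adicCompletion F)) = τ (x : F))
    (σ : AlgebraicClosure (w.adicCompletion F) →+* ℂ)
    (hσ : σ.comp ((algebraMap (w.adicCompletion F) (AlgebraicClosure (w.adicCompletion F))).comp (algebraMap F (w.adicCompletion F))) = ι₁)
    (τ τ' : F →+* AlgebraicClosure (w.adicCompletion F))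
    (hker : RingHom.ker ((residue ↥(closureValuationSubring (w.adicCompletion F))).comp (τR τ)) =
      RingHom.ker ((residue ↥(closureValuationSubring (w.adicCompletion F))).comp (τR τ')))
    (hw₁ : RingHom.ker ((residue ↥(closureValuationSubring (w.adicCompletion F))).comp (τR τ)) ≠ w.asIdeal)
    (hw₂ : RingHom.ker ((residue ↥(closureValuationSubring (w.adicCompletion F))).comp (τR τ)) ≠ ((IsCMField.complexConj F) • w).asIdeal) :
    σ.comp τ ∈ {φ : F →+* ℂ | ∃ τ ∈ Φw, φ = σ₀.comp τ} ↔ σ.comp τ' ∈ {φ : F →+* ℂ | ∃ τ ∈ Φw, φ = σ₀.comp τ} := by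
  -- the restriction family is unique
  have hRR : τR = τR₀ := funext fun τ₁ => RingHom.ext fun x => Subtype.ext ((hτR τ₁ x).trans (hτR₀ τ₁ x).symm)
  subst hRR
  -- `σ ∘ τ₁ = σ₀ ∘ τ₁` for every `τ₁` (Galois), and `σ₀ ∘ ·` is injective
  have hmem : ∀ τ₁ : F →+* AlgebraicClosure (w.adicCompletion F),
      σ.comp τ₁ ∈ {φ : F →+* ℂ | ∃ τ ∈ Φw, φ = σ₀.comp τ} ↔ τ₁ ∈ Φw := by
    intro τ₁
    rw [comp_eq_comp_of_isGalois F _ σ σ₀ (hσ.trans hσ₀.symm) τ₁]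
    refine ⟨fun ⟨τ₂, hτ₂, h⟩ => ?_, fun h => ⟨τ₁, h, rfl⟩⟩
    rwa [comp_left_injective w σ₀ h]
  rw [hmem, hmem]
  exact hunmixed τ τ' hker hw₁ hw₂

end PushForward

end Summit.HodgeConjecture.HodgeConjecture.Theorems.F0P6aKottwitzUnmixedFrame

end
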